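import Summits.CriticalPhenomena.PercolationContinuityZ3.Theorems.PercNearOneGluingNoHeavyLowerTailJBernSunflowerKleitmanAcyclic
import HarnessLib

/-!
# `NoHeavyLowerTail` (crux stmt-CriticalPhenomena-4575), hull-port line hp-7: SUNFLOWER–KLEITMAN for TWO PETALS and BOTH ORIENTATIONS AT ONCE —
# the intersecting / co-intersecting (IC) form of the mixed Harris–Kleitman row

Support file (prover `prim-hp-7`, generation 50; `--supports stmt-CriticalPhenomena-4575`).  No definitions, no `sorry`, standard axioms.
Memo: `prim-hp-7/FROM-prim-hp-7-g50-IC-KLEITMAN.md` §3.  Corollary of `JBern.card_filter_source_le_card_filter_target` (`…JBernSunflowerKleitmanAcyclic`)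
by the FOLDING (refinement) argument of the memo.

SETTING.  Two up-sets `U₁, U₂` of the cube `2^α`; petals `M₁ = U₁ ∖ U₂`, `M₂ = U₂ ∖ U₁`, kernel `W = U₁ ∩ U₂`, bottom `D = (U₁ ∪ U₂)ᶜ`;
TARGETS `t ∈ W` with `univ∖t ∈ D`.  A family `S` of antipodal middle pairs of EITHER orientation — every `ζ ∈ S` has
`(ζ ∈ M₁, univ∖ζ ∈ M₂)` or `(ζ ∈ M₂, univ∖ζ ∈ M₁)` — which is INTERSECTING (`ζ ∩ ξ ≠ ∅`) and CO-INTERSECTING (`ζ ∪ ξ ≠ univ`).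
THEOREM (`JBern.card_filter_le_card_filter_target_of_intersecting`): for every up-set `𝒰`, `#(S ∩ 𝒰) ≤ #(targets ∩ 𝒰)`; equivalently
(Hall) `S` injects increasingly into the targets.  For `S` of ONE orientation this is the mixed Harris–Kleitman row (`…JBernMixedHarris`,
p259035) = the case `k = 2` of the acyclic sunflower–Kleitman theorem; the point is that the two orientations may be MIXED as long as the
mixed pairs are intersecting and co-intersecting (for pairs of the same orientation this is automatic).  It is the two-petal case of the
"IC-Kleitman" conjecture of the memo (all petal numbers, all IC families; exhaustively verified for `|α| ≤ 5`), whose three-petal case contains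
the two open CYCLIC W-Λ rows.
PROOF (folding).  Put `X = M₁ ∪ c(M₂)` (`c` = antipode), `A` = the sources of type `(1,2)`, `B̄` = those of type `(2,1)`.  The three families
`conv B̄`, `conv X`, `conv c(A)` (`conv` = order-convex hull) are pairwise INCOMPARABLE (no member of one is contained in a member of another:
`X` versus the antipodes of its own members by up-closure of `U₁, U₂`; `c(A)` versus `B̄` by the IC hypothesis), hence their union `M′` is
order-convex, `K′ = ↑M′ ∖ M′` is an up-set, `D′ = (↑M′)ᶜ` a down-set, and the rank `ρ′ = 0 / 1 / 2` on the three families is constant along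
inclusions inside `M′`.  Every `ζ ∈ S` is a source of the ACYCLIC instance `(K′, D′, ρ′)`, and every target of that instance above a member
of `S` is an old target (the dangerous sets `↑ζ ∩ M₁`, `↑ζ ∩ c(M₂)` lie in `X ⊆ M′`).  Apply `card_filter_source_le_card_filter_target` to the
up-set `𝒰* = 𝒰 ∩ ↑(S ∩ 𝒰)`. [this work]
-/

namespace Summit.CriticalPhenomena.PercolationContinuityZ3.Theorems.JBern

open Finset
open Summit.CriticalPhenomena.PercolationContinuityZ3.Theorems.SunflowerPartition.HallGladkov

variable {α : Type*} [Fintype α] [DecidableEq α]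

/-! ## Antipode bookkeeping -/

/-- `univ ∖ (univ ∖ s) = s`. [folklore] -/
theorem univ_sdiff_univ_sdiff (s : Finset α) : univ \ (univ \ s) = s :=
  Finset.sdiff_sdiff_eq_self (subset_univ s)

/-- Antipode reverses inclusion. [folklore] -/
theorem univ_sdiff_subset_univ_sdiff {s t : Finset α} (h : s ⊆ t) : univ \ t ⊆ univ \ s :=
  Finset.sdiff_subset_sdiff (subset_refl _) h

/-- `ζ ∩ ξ` nonempty forbids `ξ ⊆ univ ∖ ζ`. [folklore] -/
theorem not_subset_univ_sdiff_of_inter_nonempty {ζ ξ : Finset α} (h : (ζ ∩ ξ).Nonempty) : ¬ ξ ⊆ univ \ ζ := by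
  intro hsub
  obtain ⟨x, hx⟩ := h
  rw [mem_inter] at hx
  have := hsub hx.2
  rw [mem_sdiff] at this
  exact this.2 hx.1

/-- `ζ ∪ ξ ≠ univ` forbids `univ ∖ ζ ⊆ ξ`. [folklore] -/
theorem not_univ_sdiff_subset_of_union_ne_univ {ζ ξ : Finset α} (h : ζ ∪ ξ ≠ univ) : ¬ univ \ ζ ⊆ ξ := by
  intro hsub
  apply h
  exact (union_eq_iff_sdiff_subset (subset_univ ζ) (subset_univ ξ)).2 hsub

/-! ## Order-convex hulls of pairwise incomparable families -/

/-- Membership in the order-convex hull `conv P = {y : x ⊆ y ⊆ w for some x, w ∈ P}`. [folklore] -/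
theorem mem_conv_iff (P : Finset (Finset α)) (y : Finset α) :
    y ∈ (univ : Finset (Finset α)).filter (fun y => ∃ x ∈ P, ∃ w ∈ P, x ⊆ y ∧ y ⊆ w) ↔ ∃ x ∈ P, ∃ w ∈ P, x ⊆ y ∧ y ⊆ w := by
  rw [mem_filter]; exact ⟨fun h => h.2, fun h => ⟨mem_univ _, h⟩⟩

/-- `P ⊆ conv P`. [folklore] -/
theorem mem_conv_self {P : Finset (Finset α)} {y : Finset α} (hy : y ∈ P) :
    y ∈ (univ : Finset (Finset α)).filter (fun y => ∃ x ∈ P, ∃ w ∈ P, x ⊆ y ∧ y ⊆ w) :=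
  (mem_conv_iff P y).2 ⟨y, hy, y, hy, subset_refl _, subset_refl _⟩

/-- `conv P` is order-convex. [folklore] -/
theorem mem_conv_of_subset_of_subset {P : Finset (Finset α)} {x y w : Finset α}
    (hx : x ∈ (univ : Finset (Finset α)).filter (fun y => ∃ x ∈ P, ∃ w ∈ P, x ⊆ y ∧ y ⊆ w))
    (hw : w ∈ (univ : Finset (Finset α)).filter (fun y => ∃ x ∈ P, ∃ w ∈ P, x ⊆ y ∧ y ⊆ w))
    (hxy : x ⊆ y) (hyw : y ⊆ w) :
    y ∈ (univ : Finset (Finset α)).filter (fun y => ∃ x ∈ P, ∃ w ∈ P, x ⊆ y ∧ y ⊆ w) := by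
  rw [mem_conv_iff] at hx hw ⊢
  obtain ⟨x₀, hx₀, -, -, hx₀x, -⟩ := hx
  obtain ⟨-, -, w₀, hw₀, -, hww₀⟩ := hw
  exact ⟨x₀, hx₀, w₀, hw₀, hx₀x.trans hxy, hyw.trans hww₀⟩

/-- Convex hulls of two CROSS-INCOMPARABLE families are cross-incomparable. [this work] -/
theorem conv_cross_incomparable {P Q : Finset (Finset α)} (h : ∀ p ∈ P, ∀ q ∈ Q, ¬ p ⊆ q ∧ ¬ q ⊆ p)
    {y z : Finset α}
    (hy : y ∈ (univ : Finset (Finset α)).filter (fun y => ∃ x ∈ P, ∃ w ∈ P, x ⊆ y ∧ y ⊆ w))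
    (hz : z ∈ (univ : Finset (Finset α)).filter (fun y => ∃ x ∈ Q, ∃ w ∈ Q, x ⊆ y ∧ y ⊆ w)) :
    ¬ y ⊆ z ∧ ¬ z ⊆ y := by
  rw [mem_conv_iff] at hy hz
  obtain ⟨x, hx, w, hw, hxy, hyw⟩ := hy
  obtain ⟨x', hx', w', hw', hxz, hzw⟩ := hz
  exact ⟨fun hyz => (h x hx w' hw').1 (hxy.trans (hyz.trans hzw)), fun hzy => (h w hw x' hx').2 (hxz.trans (hzy.trans hyw))⟩

omit [Fintype α] in
/-- Three pairwise cross-incomparable families: comparable members of their union lie in the same family. [this work] -/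
theorem pieces_of_subset {P₀ P₁ P₂ : Finset (Finset α)}
    (h01 : ∀ y ∈ P₀, ∀ z ∈ P₁, ¬ y ⊆ z ∧ ¬ z ⊆ y) (h02 : ∀ y ∈ P₀, ∀ z ∈ P₂, ¬ y ⊆ z ∧ ¬ z ⊆ y)
    (h12 : ∀ y ∈ P₁, ∀ z ∈ P₂, ¬ y ⊆ z ∧ ¬ z ⊆ y)
    {s t : Finset α} (hst : s ⊆ t) (hs : s ∈ P₀ ∪ P₁ ∪ P₂) (ht : t ∈ P₀ ∪ P₁ ∪ P₂) :
    (s ∈ P₀ ↔ t ∈ P₀) ∧ (s ∈ P₁ ↔ t ∈ P₁) ∧ (s ∈ P₂ ↔ t ∈ P₂) := by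
  simp only [mem_union] at hs ht
  rcases hs with (hs0 | hs1) | hs2 <;> rcases ht with (ht0 | ht1) | ht2
  · refine ⟨⟨fun _ => ht0, fun _ => hs0⟩, ⟨fun h => absurd (subset_refl s) (h01 s hs0 s h).1, fun h => absurd (subset_refl t) (h01 t ht0 t h).1⟩,
      ⟨fun h => absurd (subset_refl s) (h02 s hs0 s h).1, fun h => absurd (subset_refl t) (h02 t ht0 t h).1⟩⟩
  · exact absurd hst (h01 s hs0 t ht1).1
  · exact absurd hst (h02 s hs0 t ht2).1
  · exact absurd hst (h01 t ht0 s hs1).2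
  · refine ⟨⟨fun h => absurd (subset_refl s) (h01 s h s hs1).1, fun h => absurd (subset_refl t) (h01 t h t ht1).1⟩, ⟨fun _ => ht1, fun _ => hs1⟩,
      ⟨fun h => absurd (subset_refl s) (h12 s hs1 s h).1, fun h => absurd (subset_refl t) (h12 t ht1 t h).1⟩⟩
  · exact absurd hst (h12 s hs1 t ht2).1
  · exact absurd hst (h02 t ht0 s hs2).2
  · exact absurd hst (h12 t ht1 s hs2).2
  · refine ⟨⟨fun h => absurd (subset_refl s) (h02 s h s hs2).1, fun h => absurd (subset_refl t) (h02 t h t ht2).1⟩,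
      ⟨fun h => absurd (subset_refl s) (h12 s h s hs2).1, fun h => absurd (subset_refl t) (h12 t h t ht2).1⟩, ⟨fun _ => ht2, fun _ => hs2⟩⟩

/-! ## The theorem -/

/-- **Two-petal sunflower–Kleitman for intersecting, co-intersecting families of BOTH orientations** (this work; memo
`prim-hp-7/FROM-prim-hp-7-g50-IC-KLEITMAN.md` §3).  `U₁, U₂` up-sets; `S` a family of sets `ζ` with (`ζ ∈ U₁∖U₂` and `univ∖ζ ∈ U₂∖U₁`) or
(`ζ ∈ U₂∖U₁` and `univ∖ζ ∈ U₁∖U₂`), pairwise intersecting and co-intersecting; then for every up-set `𝒰` the members of `S` in `𝒰` are at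
most as many as the targets `t ∈ 𝒰` (`t ∈ U₁ ∩ U₂`, `univ∖t ∉ U₁ ∪ U₂`).  Proof: folding onto `X = (U₁∖U₂) ∪ c(U₂∖U₁)` and the acyclic
theorem `card_filter_source_le_card_filter_target` for the refined instance (module docstring). [this work] -/
theorem card_filter_le_card_filter_target_of_intersecting (U₁ U₂ : Finset (Finset α))
    (hU₁ : IsUpperSet (U₁ : Set (Finset α))) (hU₂ : IsUpperSet (U₂ : Set (Finset α)))
    (S : Finset (Finset α))
    (hS : ∀ ζ ∈ S, (ζ ∈ U₁ ∧ ζ ∉ U₂ ∧ univ \ ζ ∈ U₂ ∧ univ \ ζ ∉ U₁) ∨ (ζ ∈ U₂ ∧ ζ ∉ U₁ ∧ univ \ ζ ∈ U₁ ∧ univ \ ζ ∉ U₂))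
    (hI : ∀ ζ ∈ S, ∀ ξ ∈ S, (ζ ∩ ξ).Nonempty) (hC : ∀ ζ ∈ S, ∀ ξ ∈ S, ζ ∪ ξ ≠ univ)
    (𝒰 : Finset (Finset α)) (h𝒰 : IsUpperSet (𝒰 : Set (Finset α))) :
    #(S.filter fun ζ => ζ ∈ 𝒰) ≤ #(𝒰.filter fun t => t ∈ U₁ ∧ t ∈ U₂ ∧ univ \ t ∉ U₁ ∧ univ \ t ∉ U₂) := by
  classical
  -- the folded family X = M₁ ∪ c(M₂), the heads A = c(type-(1,2) sources), the tails B = type-(2,1) sources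
  set X : Finset (Finset α) := univ.filter (fun x => (x ∈ U₁ ∧ x ∉ U₂) ∨ (univ \ x ∈ U₂ ∧ univ \ x ∉ U₁)) with hXdef
  set A : Finset (Finset α) := (S.filter fun ζ => ζ ∈ U₁).image (fun ζ => univ \ ζ) with hAdef
  set B : Finset (Finset α) := S.filter (fun ζ => ζ ∈ U₂) with hBdef
  set P₀ : Finset (Finset α) := univ.filter (fun y => ∃ x ∈ B, ∃ w ∈ B, x ⊆ y ∧ y ⊆ w) with hP₀def
  set P₁ : Finset (Finset α) := univ.filter (fun y => ∃ x ∈ X, ∃ w ∈ X, x ⊆ y ∧ y ⊆ w) with hP₁def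
  set P₂ : Finset (Finset α) := univ.filter (fun y => ∃ x ∈ A, ∃ w ∈ A, x ⊆ y ∧ y ⊆ w) with hP₂def
  set M : Finset (Finset α) := P₀ ∪ P₁ ∪ P₂ with hMdef
  set K' : Finset (Finset α) := univ.filter (fun t => t ∉ M ∧ ∃ m ∈ M, m ⊆ t) with hK'def
  set D' : Finset (Finset α) := univ.filter (fun t => ∀ m ∈ M, ¬ m ⊆ t) with hD'def
  let ρ : Finset α → ℕ := fun t => if t ∈ P₀ then 0 else if t ∈ P₁ then 1 else 2
  -- membership bookkeeping
  have hmemX : ∀ x : Finset α, x ∈ X ↔ (x ∈ U₁ ∧ x ∉ U₂) ∨ (univ \ x ∈ U₂ ∧ univ \ x ∉ U₁) := fun x => by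
    rw [hXdef, mem_filter]; exact ⟨fun h => h.2, fun h => ⟨mem_univ _, h⟩⟩
  have hmemA : ∀ y : Finset α, y ∈ A ↔ ∃ ζ ∈ S, ζ ∈ U₁ ∧ univ \ ζ = y := fun y => by
    rw [hAdef, mem_image]
    constructor
    · rintro ⟨ζ, hζ, rfl⟩; rw [mem_filter] at hζ; exact ⟨ζ, hζ.1, hζ.2, rfl⟩
    · rintro ⟨ζ, hζS, hζ1, rfl⟩; exact ⟨ζ, mem_filter.2 ⟨hζS, hζ1⟩, rfl⟩
  have hmemB : ∀ y : Finset α, y ∈ B ↔ y ∈ S ∧ y ∈ U₂ := fun y => by rw [hBdef, mem_filter]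
  have hmemK' : ∀ t : Finset α, t ∈ K' ↔ t ∉ M ∧ ∃ m ∈ M, m ⊆ t := fun t => by
    rw [hK'def, mem_filter]; exact ⟨fun h => h.2, fun h => ⟨mem_univ _, h⟩⟩
  have hmemD' : ∀ t : Finset α, t ∈ D' ↔ ∀ m ∈ M, ¬ m ⊆ t := fun t => by
    rw [hD'def, mem_filter]; exact ⟨fun h => h.2, fun h => ⟨mem_univ _, h⟩⟩
  have hmemM : ∀ y : Finset α, y ∈ M ↔ y ∈ P₀ ∨ y ∈ P₁ ∨ y ∈ P₂ := fun y => by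
    rw [hMdef, mem_union, mem_union, or_assoc]
  -- the type of a source: (1,2) means ζ ∈ U₁ (then all four facts), (2,1) means ζ ∈ U₂
  have htype1 : ∀ ζ ∈ S, ζ ∈ U₁ → (ζ ∈ U₁ ∧ ζ ∉ U₂ ∧ univ \ ζ ∈ U₂ ∧ univ \ ζ ∉ U₁) := fun ζ hζ h1 => by
    rcases hS ζ hζ with h | h
    · exact h
    · exact absurd h1 h.2.1
  have htype2 : ∀ ζ ∈ S, ζ ∈ U₂ → (ζ ∈ U₂ ∧ ζ ∉ U₁ ∧ univ \ ζ ∈ U₁ ∧ univ \ ζ ∉ U₂) := fun ζ hζ h2 => by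
    rcases hS ζ hζ with h | h
    · exact absurd h2 h.2.1
    · exact h
  -- Q-sets (`q ∈ U₂∖U₁`, `univ∖q ∈ U₁∖U₂`) are incomparable with X
  have hXQ : ∀ x ∈ X, ∀ q : Finset α, (q ∈ U₂ ∧ q ∉ U₁ ∧ univ \ q ∈ U₁ ∧ univ \ q ∉ U₂) → ¬ x ⊆ q ∧ ¬ q ⊆ x := by
    intro x hx q hq
    rw [hmemX] at hx
    rcases hx with ⟨hx1, hx2⟩ | ⟨hcx2, hcx1⟩
    · exact ⟨fun h => hq.2.1 (hU₁ h hx1), fun h => hx2 (hU₂ h hq.1)⟩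
    · refine ⟨fun h => hcx1 (hU₁ (univ_sdiff_subset_univ_sdiff h) hq.2.2.1), fun h => hq.2.2.2 (hU₂ (univ_sdiff_subset_univ_sdiff h) hcx2)⟩
  have hAQ : ∀ y ∈ A, (y ∈ U₂ ∧ y ∉ U₁ ∧ univ \ y ∈ U₁ ∧ univ \ y ∉ U₂) := by
    intro y hy
    obtain ⟨ζ, hζS, hζ1, rfl⟩ := (hmemA y).1 hy
    have h := htype1 ζ hζS hζ1
    rw [univ_sdiff_univ_sdiff]
    exact ⟨h.2.2.1, h.2.2.2, h.1, h.2.1⟩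
  have hBQ : ∀ y ∈ B, (y ∈ U₂ ∧ y ∉ U₁ ∧ univ \ y ∈ U₁ ∧ univ \ y ∉ U₂) := by
    intro y hy
    obtain ⟨hyS, hy2⟩ := (hmemB y).1 hy
    exact htype2 y hyS hy2
  -- the three base families are pairwise cross-incomparable
  have hBX : ∀ y ∈ B, ∀ z ∈ X, ¬ y ⊆ z ∧ ¬ z ⊆ y := fun y hy z hz =>
    ⟨(hXQ z hz y (hBQ y hy)).2, (hXQ z hz y (hBQ y hy)).1⟩
  have hXA : ∀ y ∈ X, ∀ z ∈ A, ¬ y ⊆ z ∧ ¬ z ⊆ y := fun y hy z hz => hXQ y hy z (hAQ z hz)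
  have hBA : ∀ y ∈ B, ∀ z ∈ A, ¬ y ⊆ z ∧ ¬ z ⊆ y := by
    intro y hy z hz
    obtain ⟨hyS, -⟩ := (hmemB y).1 hy
    obtain ⟨ζ, hζS, -, rfl⟩ := (hmemA z).1 hz
    exact ⟨not_subset_univ_sdiff_of_inter_nonempty (hI ζ hζS y hyS), not_univ_sdiff_subset_of_union_ne_univ (hC ζ hζS y hyS)⟩
  have h01 : ∀ y ∈ P₀, ∀ z ∈ P₁, ¬ y ⊆ z ∧ ¬ z ⊆ y := fun y hy z hz => conv_cross_incomparable hBX hy hz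
  have h02 : ∀ y ∈ P₀, ∀ z ∈ P₂, ¬ y ⊆ z ∧ ¬ z ⊆ y := fun y hy z hz => conv_cross_incomparable hBA hy hz
  have h12 : ∀ y ∈ P₁, ∀ z ∈ P₂, ¬ y ⊆ z ∧ ¬ z ⊆ y := fun y hy z hz => conv_cross_incomparable hXA hy hz
  -- M is order-convex
  have hMconv : ∀ m y m' : Finset α, m ∈ M → m' ∈ M → m ⊆ y → y ⊆ m' → y ∈ M := by
    intro m y m' hm hm' hmy hym'
    have hp := pieces_of_subset h01 h02 h12 (hmy.trans hym') hm hm'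
    rw [hmemM] at hm hm' ⊢
    rcases hm with hm0 | hm1 | hm2
    · exact Or.inl (mem_conv_of_subset_of_subset hm0 (hp.1.1 hm0) hmy hym')
    · exact Or.inr (Or.inl (mem_conv_of_subset_of_subset hm1 (hp.2.1.1 hm1) hmy hym'))
    · exact Or.inr (Or.inr (mem_conv_of_subset_of_subset hm2 (hp.2.2.1 hm2) hmy hym'))
  -- the refined instance (K', D', ρ)
  have hK' : IsUpperSet (K' : Set (Finset α)) := by
    intro s t hst hs
    rw [Finset.mem_coe, hmemK'] at hs ⊢
    obtain ⟨hsM, m, hmM, hms⟩ := hs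
    exact ⟨fun htM => hsM (hMconv m s t hmM htM hms hst), m, hmM, hms.trans hst⟩
  have hD' : IsLowerSet (D' : Set (Finset α)) := by
    intro s t hts hs
    rw [Finset.mem_coe, hmemD'] at hs ⊢
    exact fun m hmM hmt => hs m hmM (hmt.trans hts)
  have hKD' : Disjoint K' D' := by
    rw [Finset.disjoint_left]
    intro t htK htD
    rw [hmemK'] at htK; rw [hmemD'] at htD
    obtain ⟨-, m, hmM, hmt⟩ := htK
    exact htD m hmM hmt
  have hρ : ∀ s t : Finset α, s ⊆ t → s ∉ D' → t ∉ K' → ρ s = ρ t := by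
    intro s t hst hsD htK
    rw [hmemD'] at hsD; rw [hmemK'] at htK
    simp only [not_forall, not_not] at hsD
    obtain ⟨m, hmM, hms⟩ := hsD
    have htM : t ∈ M := by
      by_contra h
      exact htK ⟨h, m, hmM, hms.trans hst⟩
    have hsM : s ∈ M := hMconv m s t hmM htM hms hst
    have hp := pieces_of_subset h01 h02 h12 hst hsM htM
    show (if s ∈ P₀ then 0 else if s ∈ P₁ then 1 else 2) = (if t ∈ P₀ then 0 else if t ∈ P₁ then 1 else 2)
    by_cases h0 : s ∈ P₀
    · rw [if_pos h0, if_pos (hp.1.1 h0)]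
    · rw [if_neg h0, if_neg (fun h => h0 (hp.1.2 h))]
      by_cases h1 : s ∈ P₁
      · rw [if_pos h1, if_pos (hp.2.1.1 h1)]
      · rw [if_neg h1, if_neg (fun h => h1 (hp.2.1.2 h))]
  -- values of ρ on the three families
  have hρ0 : ∀ y ∈ P₀, ρ y = 0 := fun y hy => by
    show (if y ∈ P₀ then 0 else if y ∈ P₁ then 1 else 2) = 0
    rw [if_pos hy]
  have hρ1 : ∀ y ∈ P₁, ρ y = 1 := fun y hy => by
    show (if y ∈ P₀ then 0 else if y ∈ P₁ then 1 else 2) = 1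
    rw [if_neg (fun h => (h01 y h y hy).1 (subset_refl y)), if_pos hy]
  have hρ2 : ∀ y ∈ P₂, ρ y = 2 := fun y hy => by
    show (if y ∈ P₀ then 0 else if y ∈ P₁ then 1 else 2) = 2
    rw [if_neg (fun h => (h02 y h y hy).1 (subset_refl y)), if_neg (fun h => (h12 y h y hy).1 (subset_refl y))]
  have hP₀M : ∀ y ∈ P₀, y ∈ M := fun y hy => (hmemM y).2 (Or.inl hy)
  have hP₁M : ∀ y ∈ P₁, y ∈ M := fun y hy => (hmemM y).2 (Or.inr (Or.inl hy))
  have hP₂M : ∀ y ∈ P₂, y ∈ M := fun y hy => (hmemM y).2 (Or.inr (Or.inr hy))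
  have hM_notK : ∀ y ∈ M, y ∉ K' := fun y hy h => ((hmemK' y).1 h).1 hy
  have hM_notD : ∀ y ∈ M, y ∉ D' := fun y hy h => (hmemD' y).1 h y hy (subset_refl y)
  -- every ζ ∈ S is a source of the refined instance
  have hsrc : ∀ ζ ∈ S, ζ ∉ K' ∧ ζ ∉ D' ∧ univ \ ζ ∉ K' ∧ univ \ ζ ∉ D' ∧ ρ ζ < ρ (univ \ ζ) := by
    intro ζ hζ
    rcases hS ζ hζ with h | h
    · -- type (1,2): ζ ∈ X ⊆ P₁, univ∖ζ ∈ A ⊆ P₂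
      have hζX : ζ ∈ X := (hmemX ζ).2 (Or.inl ⟨h.1, h.2.1⟩)
      have hζP : ζ ∈ P₁ := mem_conv_self hζX
      have hcA : univ \ ζ ∈ A := (hmemA _).2 ⟨ζ, hζ, h.1, rfl⟩
      have hcP : univ \ ζ ∈ P₂ := mem_conv_self hcA
      refine ⟨hM_notK ζ (hP₁M ζ hζP), hM_notD ζ (hP₁M ζ hζP), hM_notK _ (hP₂M _ hcP), hM_notD _ (hP₂M _ hcP), ?_⟩
      rw [hρ1 ζ hζP, hρ2 _ hcP]; exact Nat.lt_succ_self 1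
    · -- type (2,1): ζ ∈ B ⊆ P₀, univ∖ζ ∈ X ⊆ P₁
      have hζB : ζ ∈ B := (hmemB ζ).2 ⟨hζ, h.1⟩
      have hζP : ζ ∈ P₀ := mem_conv_self hζB
      have hcX : univ \ ζ ∈ X := (hmemX _).2 (Or.inl ⟨h.2.2.1, h.2.2.2⟩)
      have hcP : univ \ ζ ∈ P₁ := mem_conv_self hcX
      refine ⟨hM_notK ζ (hP₀M ζ hζP), hM_notD ζ (hP₀M ζ hζP), hM_notK _ (hP₁M _ hcP), hM_notD _ (hP₁M _ hcP), ?_⟩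
      rw [hρ0 ζ hζP, hρ1 _ hcP]; exact Nat.lt_succ_self 0
  -- every target of the refined instance above a member of S is an old target
  have htgt : ∀ ζ ∈ S, ∀ t : Finset α, ζ ⊆ t → t ∈ K' → univ \ t ∈ D' →
      (t ∈ U₁ ∧ t ∈ U₂ ∧ univ \ t ∉ U₁ ∧ univ \ t ∉ U₂) := by
    intro ζ hζ t hζt htK hctD
    have htM : t ∉ M := ((hmemK' t).1 htK).1
    have hctD' := (hmemD' _).1 hctD
    have hct : univ \ t ⊆ univ \ ζ := univ_sdiff_subset_univ_sdiff hζt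
    rcases hS ζ hζ with h | h
    · -- ζ ∈ U₁∖U₂, univ∖ζ ∈ U₂∖U₁
      have ht1 : t ∈ U₁ := hU₁ hζt h.1
      have ht2 : t ∈ U₂ := by
        by_contra ht2
        exact htM (hP₁M t (mem_conv_self ((hmemX t).2 (Or.inl ⟨ht1, ht2⟩))))
      have hct1 : univ \ t ∉ U₁ := fun hc => h.2.2.2 (hU₁ hct hc)
      have hct2 : univ \ t ∉ U₂ := fun hc =>
        htM (hP₁M t (mem_conv_self ((hmemX t).2 (Or.inr ⟨hc, hct1⟩))))
      exact ⟨ht1, ht2, hct1, hct2⟩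
    · -- ζ ∈ U₂∖U₁, univ∖ζ ∈ U₁∖U₂
      have ht2 : t ∈ U₂ := hU₂ hζt h.1
      have ht1 : t ∈ U₁ := by
        by_contra ht1
        have hcX : univ \ t ∈ X := (hmemX _).2 (Or.inr (by rw [univ_sdiff_univ_sdiff]; exact ⟨ht2, ht1⟩))
        exact hctD' _ (hP₁M _ (mem_conv_self hcX)) (subset_refl _)
      have hct2 : univ \ t ∉ U₂ := fun hc => h.2.2.2 (hU₂ hct hc)
      have hct1 : univ \ t ∉ U₁ := fun hc =>
        hctD' _ (hP₁M _ (mem_conv_self ((hmemX _).2 (Or.inl ⟨hc, hct2⟩)))) (subset_refl _)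
      exact ⟨ht1, ht2, hct1, hct2⟩
  -- the up-set 𝒰* = 𝒰 ∩ ↑(S ∩ 𝒰)
  set V : Finset (Finset α) := 𝒰.filter (fun t => ∃ ζ ∈ S, ζ ∈ 𝒰 ∧ ζ ⊆ t) with hVdef
  have hmemV : ∀ t : Finset α, t ∈ V ↔ t ∈ 𝒰 ∧ ∃ ζ ∈ S, ζ ∈ 𝒰 ∧ ζ ⊆ t := fun t => by rw [hVdef, mem_filter]
  have hV : IsUpperSet (V : Set (Finset α)) := by
    intro s t hst hs
    rw [Finset.mem_coe, hmemV] at hs ⊢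
    obtain ⟨hs𝒰, ζ, hζS, hζ𝒰, hζs⟩ := hs
    exact ⟨h𝒰 hst hs𝒰, ζ, hζS, hζ𝒰, hζs.trans hst⟩
  have main := card_filter_source_le_card_filter_target K' D' ρ hK' hD' hKD' hρ V hV
  calc #(S.filter fun ζ => ζ ∈ 𝒰)
      ≤ #(V.filter fun ζ => ζ ∉ K' ∧ ζ ∉ D' ∧ univ \ ζ ∉ K' ∧ univ \ ζ ∉ D' ∧ ρ ζ < ρ (univ \ ζ)) := by
        refine card_le_card fun ζ hζ => ?_
        rw [mem_filter] at hζ ⊢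
        exact ⟨(hmemV ζ).2 ⟨hζ.2, ζ, hζ.1, hζ.2, subset_refl ζ⟩, hsrc ζ hζ.1⟩
    _ ≤ #(V.filter fun ζ => ζ ∈ K' ∧ univ \ ζ ∈ D') := main
    _ ≤ #(𝒰.filter fun t => t ∈ U₁ ∧ t ∈ U₂ ∧ univ \ t ∉ U₁ ∧ univ \ t ∉ U₂) := by
        refine card_le_card fun t ht => ?_
        rw [mem_filter] at ht ⊢
        obtain ⟨htV, htK, hctD⟩ := ht
        obtain ⟨ht𝒰, ζ, hζS, -, hζt⟩ := (hmemV t).1 htV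
        exact ⟨ht𝒰, htgt ζ hζS t hζt htK hctD⟩

end Summit.CriticalPhenomena.PercolationContinuityZ3.Theorems.JBern
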